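import Mathlib
import Summits.ResolutionOfSingularities.ResolutionOfSingularities.Theorems.WildQuotientsWildQuotientResolutionToricExitWeightZero
import Summits.ResolutionOfSingularities.ResolutionOfSingularities.Theorems.WildQuotientsWildQuotientResolutionToricExitRootSubstInjective

/-!
# The ℤ9 specimen, Z4a ring side (1/2): the `x_a`-root substitution and the `μ₇`-weight-`0` part

(crux stmt-ResolutionOfSingularities-15640 `WildQuotients.WildQuotientResolution`, S1 = stmt-…-17941
`CyclicQuotientFourfolds`; ℤ9 SPECIMEN of res-L1-w45c-idea-2's card P (`cardP_g12/Z9-SPECIMEN.md`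
§1–§2, piece `P₀ = D₊(x_a⁴ t)` of `V = Bl_{I₂₈} 𝔸ⁿ`), res-L1-w45c-plan-1 RE-POINT 2026-08-27T17:20:36Z
«stub-1: Z4a RING SIDE»; the ℤ9 twin of res-L1-w45c-stub-4's (A2) `JordanFive.adjoin_root5_eq_weightZero`
(p538619). [OURS · L1 W4.5c] — NOT a statement of any manuscript; replaces the role of no printed
item. Prover res-L1-w45c-stub-1. Def-free. Letters: res-L1-w45c-plan-1 16:29:52Z (`a b c` on
`MvPolynomial (Fin n) k`), the exponent table `e24` of res-D-pv-033's `…Z9PeeledI28Stable`, and the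
root substitution literal of res-L1-w45c-stub-3's `…Z9PeeledRootChartAKL`.)

The `x_a`-vertex chart of the `(7,4,1 | 0)`-weighted blow-up is the `μ₇`-quotient of the ROOT CHART
`k[s, b′, c′, …]` (`x_a = s⁷, x_b = s⁴ b′, x_c = s c′`; `μ₇`-weights `s : 1, b′ : 3, c′ : 6`, passengers
`0`), i.e. its ring is the weight-`0` part. Here `k[x]` doubles as the root chart (`s = X a`, `b′ = X b`,
`c′ = X c`) and `ψ₀ = aeval (x_a ↦ x_a⁷, x_b ↦ x_a⁴x_b, x_c ↦ x_ax_c)` is the root substitution.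

* `rootA_X_*`, `aeval_rootA_eq_monomialTwist`, `aeval_rootA_injective` — values and injectivity of `ψ₀`;
* `aeval_rootA_gens` — `ψ₀ (g_j) = q_j · ψ₀ (x_a⁴)` with the RATIO monomials
  `q_j = x_a^{7i+4j+l−28} x_b^j x_c^l` (`(i,j,l) = e24 j`);
* `monomial_mem_of_seven_dvd` — **the weight-`0` monoid `{α + 3β + 6γ ≡ 0 (7)}` is generated by its nine
  Hilbert monomials** `x_a⁷, x_a⁴x_b, x_ax_c, x_ax_b², x_bx_c³, x_b³x_c², x_b⁵x_c, x_b⁷, x_c⁷`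
  (box step by `decide` over `Fin 7³`, then strong induction);
* `mem_adjoin_rootA_iff_isWeightedHomogeneous_zero` — hence
  `k[ψ₀(x_i) : i][q_j : j] = {f | IsWeightedHomogeneous w f 0}` for the `μ₇`-weight `w(a,b,c) = (1,3,6)`,
  `0` on passengers (`ToricExit.mem_adjoin_iff_isWeightedHomogeneous_zero`, p490929): the nine Hilbert
  monomials are `ψ₀(x_a), ψ₀(x_b), ψ₀(x_c), q₁, q₂, q₅, q₁₀, q₁₆, q₃`.
-/

-- single-problem summit: the doubled namespace component `ResolutionOfSingularities` is forced
set_option linter.dupNamespace false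

noncomputable section

open MvPolynomial

namespace Summit.ResolutionOfSingularities.ResolutionOfSingularities.Theorems.WildQuotientResolution.Z9Peeled

variable (k : Type) [Field k] (n : ℕ) (a b c : Fin n)

/-- The exponent table of the 24 generators of `I₂₈` (res-D-pv-033's `e24`, verbatim). -/
local notation3 "e24" => (![(4, 0, 0), (3, 2, 0), (3, 1, 3), (3, 0, 7), (2, 4, 0), (2, 3, 2), (2, 2, 6), (2, 1, 10), (2, 0, 14), (1, 6, 0), (1, 5, 1), (1, 4, 5), (1, 3, 9), (1, 2, 13), (1, 1, 17), (1, 0, 21), (0, 7, 0), (0, 6, 4), (0, 5, 8), (0, 4, 12), (0, 3, 16), (0, 2, 20), (0, 1, 24), (0, 0, 28)] : Fin 24 → ℕ × ℕ × ℕ)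
/-- The root substitution `ψ₀` of the `x_a`-vertex chart (res-L1-w45c-stub-3's literal, verbatim). -/
local notation3 "r₇" => (fun i : Fin n => if i = a then X a ^ 7 else if i = b then X a ^ 4 * X b
    else if i = c then X a * X c else (X i : MvPolynomial (Fin n) k))
/-- The ratio monomials `q_j = ψ₀(g_j) / ψ₀(x_a⁴)`. -/
local notation3 "q24" => (fun j : Fin 24 => (X a ^ (7 * (e24 j).1 + 4 * (e24 j).2.1 + (e24 j).2.2 - 28) *
    X b ^ (e24 j).2.1 * X c ^ (e24 j).2.2 : MvPolynomial (Fin n) k))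

/-! ## The root substitution -/

/-- `ψ₀ (x_a) = s⁷`. [OURS · L1 W4.5c] -/
theorem rootA_X_a : aeval r₇ (X a : MvPolynomial (Fin n) k) = X a ^ 7 := by
  rw [aeval_X]; simp

variable {a b} in
/-- `ψ₀ (x_b) = s⁴ b′`. [OURS · L1 W4.5c] -/
theorem rootA_X_b (hab : a ≠ b) : aeval r₇ (X b : MvPolynomial (Fin n) k) = X a ^ 4 * X b := by
  rw [aeval_X]; simp [hab.symm]

variable {a b c} in
/-- `ψ₀ (x_c) = s c′`. [OURS · L1 W4.5c] -/
theorem rootA_X_c (hac : a ≠ c) (hbc : b ≠ c) :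
    aeval r₇ (X c : MvPolynomial (Fin n) k) = X a * X c := by
  rw [aeval_X]; simp [hac.symm, hbc.symm]

variable {a b c} in
/-- `ψ₀ (x_i) = x_i` for `i ∉ {a, b, c}`. [OURS · L1 W4.5c] -/
theorem rootA_X_of_ne {i : Fin n} (hia : i ≠ a) (hib : i ≠ b) (hic : i ≠ c) :
    aeval r₇ (X i : MvPolynomial (Fin n) k) = X i := by
  rw [aeval_X]; simp [hia, hib, hic]

variable {a b c} in
/-- `ψ₀` is the monomial twist `x_a ↦ x_a⁷, x_s ↦ x_s · x_a^{e_s}`, `e = (b ↦ 4, c ↦ 1, else 0)`.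
[folklore] -/
theorem aeval_rootA_eq_monomialTwist (hab : a ≠ b) (hac : a ≠ c) (hbc : b ≠ c) :
    (aeval r₇ : MvPolynomial (Fin n) k →ₐ[k] MvPolynomial (Fin n) k) =
      aeval (fun s : Fin n => (if s = a then X a ^ 7 else
        X s * X a ^ ((fun s : Fin n => if s = b then 4 else if s = c then 1 else 0) s) :
          MvPolynomial (Fin n) k)) := by
  refine MvPolynomial.algHom_ext fun i => ?_
  rw [aeval_X, aeval_X]
  by_cases hia : i = a
  · subst hia; simp
  by_cases hib : i = b
  · subst hib; simp [hia]; ring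
  by_cases hic : i = c
  · subst hic; simp [hia, hib]; ring
  · simp [hia, hib, hic]

variable {a b c} in
/-- `ψ₀` is injective. [folklore] -/
theorem aeval_rootA_injective (hab : a ≠ b) (hac : a ≠ c) (hbc : b ≠ c) :
    Function.Injective (aeval r₇ : MvPolynomial (Fin n) k →ₐ[k] MvPolynomial (Fin n) k) := by
  rw [aeval_rootA_eq_monomialTwist k n hab hac hbc]
  exact ToricExit.monomialTwist_injective k n a 7 (by norm_num) _

variable {a b c} in
/-- The ratio law: `ψ₀ (g_j) = q_j · ψ₀ (g_0)` (`g_0 = x_a⁴`, `ψ₀ (g_0) = s²⁸`) for the 24 generators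
of `I₂₈`. [folklore] -/
theorem aeval_rootA_gens (hab : a ≠ b) (hac : a ≠ c) (hbc : b ≠ c)
    (g : Fin 24 → MvPolynomial (Fin n) k)
    (hg : ∀ q, g q = X a ^ (e24 q).1 * X b ^ (e24 q).2.1 * X c ^ (e24 q).2.2) (j : Fin 24) :
    aeval r₇ (g j) = q24 j * aeval r₇ (g 0) := by
  have hra := rootA_X_a k n a b c
  have hrb := rootA_X_b k n (c := c) hab
  have hrc := rootA_X_c k n hac hbc
  rw [hg j, hg 0]
  simp only [map_mul, map_pow, hra, hrb, hrc]
  fin_cases j <;> simp <;> ring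

/-! ## The weight-`0` monoid of `⅐(1,3,6)` is generated by its nine Hilbert monomials -/

/-- Box step: a non-zero `(α, β, γ) ∈ [0,6]³` with `7 ∣ α + 3β + 6γ` dominates one of the six small
Hilbert vectors `(4,1,0), (1,0,1), (1,2,0), (0,1,3), (0,3,2), (0,5,1)`. [folklore; `decide`] -/
theorem box_step : ∀ α β γ : Fin 7, ((α : ℕ) + 3 * β + 6 * γ) % 7 = 0 →
    ¬ ((α : ℕ) = 0 ∧ (β : ℕ) = 0 ∧ (γ : ℕ) = 0) →
    (4 ≤ (α : ℕ) ∧ 1 ≤ (β : ℕ)) ∨ (1 ≤ (α : ℕ) ∧ 1 ≤ (γ : ℕ)) ∨ (1 ≤ (α : ℕ) ∧ 2 ≤ (β : ℕ)) ∨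
      (1 ≤ (β : ℕ) ∧ 3 ≤ (γ : ℕ)) ∨ (3 ≤ (β : ℕ) ∧ 2 ≤ (γ : ℕ)) ∨ (5 ≤ (β : ℕ) ∧ 1 ≤ (γ : ℕ)) := by
  decide

/-- **Monoid generation.** For a subalgebra `A ⊆ k[x]` containing the nine Hilbert monomials
`x_a⁷, x_a⁴x_b, x_ax_c, x_ax_b², x_bx_c³, x_b³x_c², x_b⁵x_c, x_b⁷, x_c⁷` of `⅐(1,3,6)`, every monomial
`x_a^α x_b^β x_c^γ` with `7 ∣ α + 3β + 6γ` lies in `A` (peel off `7`'s, then the box step, by strong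
induction on `α + β + γ`). [folklore] -/
theorem monomial_mem_of_seven_dvd (A : Subalgebra k (MvPolynomial (Fin n) k))
    (h700 : (X a ^ 7 : MvPolynomial (Fin n) k) ∈ A) (h410 : (X a ^ 4 * X b : MvPolynomial (Fin n) k) ∈ A)
    (h101 : (X a * X c : MvPolynomial (Fin n) k) ∈ A) (h120 : (X a * X b ^ 2 : MvPolynomial (Fin n) k) ∈ A)
    (h013 : (X b * X c ^ 3 : MvPolynomial (Fin n) k) ∈ A)
    (h032 : (X b ^ 3 * X c ^ 2 : MvPolynomial (Fin n) k) ∈ A)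
    (h051 : (X b ^ 5 * X c : MvPolynomial (Fin n) k) ∈ A) (h070 : (X b ^ 7 : MvPolynomial (Fin n) k) ∈ A)
    (h007 : (X c ^ 7 : MvPolynomial (Fin n) k) ∈ A) :
    ∀ α β γ : ℕ, 7 ∣ α + 3 * β + 6 * γ →
      (X a ^ α * X b ^ β * X c ^ γ : MvPolynomial (Fin n) k) ∈ A := by
  -- strong induction on `α + β + γ`
  suffices H : ∀ N : ℕ, ∀ α β γ : ℕ, α + β + γ ≤ N → 7 ∣ α + 3 * β + 6 * γ →
      (X a ^ α * X b ^ β * X c ^ γ : MvPolynomial (Fin n) k) ∈ A from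
    fun α β γ h => H _ α β γ le_rfl h
  intro N
  induction N with
  | zero =>
    intro α β γ hN _
    have hα : α = 0 := by omega
    have hβ : β = 0 := by omega
    have hγ : γ = 0 := by omega
    subst hα; subst hβ; subst hγ
    simp only [pow_zero, mul_one]
    exact A.one_mem
  | succ N ih =>
    intro α β γ hN hdvd
    -- generic peeling step: `x^{(α,β,γ)} = x^v · x^{(α,β,γ) − v}` with `v` a Hilbert vector in `A`
    have peel : ∀ (u v w : ℕ), u ≤ α → v ≤ β → w ≤ γ → 0 < u + v + w → 7 ∣ u + 3 * v + 6 * w →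
        (X a ^ u * X b ^ v * X c ^ w : MvPolynomial (Fin n) k) ∈ A →
        (X a ^ α * X b ^ β * X c ^ γ : MvPolynomial (Fin n) k) ∈ A := by
      intro u v w hu hv hw hpos hdvd' hmem
      have h' : (X a ^ α * X b ^ β * X c ^ γ : MvPolynomial (Fin n) k) =
          (X a ^ u * X b ^ v * X c ^ w) * (X a ^ (α - u) * X b ^ (β - v) * X c ^ (γ - w)) := by
        rw [show α = u + (α - u) by omega, show β = v + (β - v) by omega,
          show γ = w + (γ - w) by omega]
        simp only [pow_add, Nat.add_sub_cancel_left]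
        ring
      rw [h']
      refine A.mul_mem hmem (ih _ _ _ (by omega) ?_)
      have : u + 3 * v + 6 * w + ((α - u) + 3 * (β - v) + 6 * (γ - w)) = α + 3 * β + 6 * γ := by
        omega
      exact (Nat.dvd_add_right hdvd').mp (this ▸ hdvd)
    by_cases hα7 : 7 ≤ α
    · exact peel 7 0 0 hα7 (Nat.zero_le _) (Nat.zero_le _) (by norm_num) (by norm_num)
        (by simpa using h700)
    by_cases hβ7 : 7 ≤ β
    · exact peel 0 7 0 (Nat.zero_le _) hβ7 (Nat.zero_le _) (by norm_num) (by norm_num)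
        (by simpa using h070)
    by_cases hγ7 : 7 ≤ γ
    · exact peel 0 0 7 (Nat.zero_le _) (Nat.zero_le _) hγ7 (by norm_num) (by norm_num)
        (by simpa using h007)
    by_cases h0 : α = 0 ∧ β = 0 ∧ γ = 0
    · obtain ⟨rfl, rfl, rfl⟩ := h0
      simp only [pow_zero, mul_one]
      exact A.one_mem
    -- the box step
    have hbox := box_step ⟨α, by omega⟩ ⟨β, by omega⟩ ⟨γ, by omega⟩
      (by simpa using Nat.eq_zero_of_dvd_of_lt ((Nat.dvd_iff_mod_eq_zero).mp hdvd ▸ ⟨0, by simp⟩ : 7 ∣ (α + 3 * β + 6 * γ) % 7) (Nat.mod_lt _ (by norm_num)) ) h0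
    rcases hbox with ⟨h1, h2⟩ | ⟨h1, h2⟩ | ⟨h1, h2⟩ | ⟨h1, h2⟩ | ⟨h1, h2⟩ | ⟨h1, h2⟩
    · exact peel 4 1 0 h1 h2 (Nat.zero_le _) (by norm_num) (by norm_num) (by simpa using h410)
    · exact peel 1 0 1 h1 (Nat.zero_le _) h2 (by norm_num) (by norm_num) (by simpa using h101)
    · exact peel 1 2 0 h1 h2 (Nat.zero_le _) (by norm_num) (by norm_num) (by simpa using h120)
    · exact peel 0 1 3 (Nat.zero_le _) h1 h2 (by norm_num) (by norm_num) (by simpa using h013)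
    · exact peel 0 3 2 (Nat.zero_le _) h1 h2 (by norm_num) (by norm_num) (by simpa using h032)
    · exact peel 0 5 1 (Nat.zero_le _) h1 h2 (by norm_num) (by norm_num) (by simpa using h051)

/-! ## `k[ψ₀(x_i), q_j] =` the weight-`0` part -/

variable {a b c} in
/-- **(A2, ℤ9)**: for the `μ₇`-weight `w` with `w(a,b,c) = (1,3,6)` and `w = 0` on passengers, the
subalgebra generated by the root images `ψ₀(x_i)` and the ratio monomials `q_j` IS the weight-`0` part
of `k[x]`. [OURS · L1 W4.5c] [folklore; assembly] -/
theorem mem_adjoin_rootA_iff_isWeightedHomogeneous_zero (hab : a ≠ b) (hac : a ≠ c) (hbc : b ≠ c)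
    (w : Fin n → ZMod 7) (hwa : w a = 1) (hwb : w b = 3) (hwc : w c = 6)
    (hw0 : ∀ i, i ≠ a → i ≠ b → i ≠ c → w i = 0) (f : MvPolynomial (Fin n) k) :
    f ∈ Algebra.adjoin k (Set.range (fun s : Fin n => aeval r₇ (X s : MvPolynomial (Fin n) k)) ∪
        Set.range q24) ↔ IsWeightedHomogeneous w f 0 := by
  classical
  set G : Set (MvPolynomial (Fin n) k) :=
    Set.range (fun s : Fin n => aeval r₇ (X s : MvPolynomial (Fin n) k)) ∪ Set.range q24 with hG
  set A := Algebra.adjoin k G with hA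
  -- weight of a monomial `x_a^α x_b^β x_c^γ`
  have hwmon : ∀ α β γ : ℕ, 7 ∣ α + 3 * β + 6 * γ →
      IsWeightedHomogeneous w (X a ^ α * X b ^ β * X c ^ γ : MvPolynomial (Fin n) k) 0 := by
    intro α β γ h
    have ha := (isWeightedHomogeneous_X k w a).pow α
    have hb := (isWeightedHomogeneous_X k w b).pow β
    have hc := (isWeightedHomogeneous_X k w c).pow γ
    have habc := (ha.mul hb).mul hc
    have hdeg : α • w a + β • w b + γ • w c = 0 := by
      rw [hwa, hwb, hwc]
      obtain ⟨m, hm⟩ := h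
      have h7 : ((α + 3 * β + 6 * γ : ℕ) : ZMod 7) = 0 := by
        rw [hm]; push_cast; rw [show (7 : ZMod 7) = 0 from rfl, zero_mul]
      have e : α • (1 : ZMod 7) + β • (3 : ZMod 7) + γ • (6 : ZMod 7) =
          ((α + 3 * β + 6 * γ : ℕ) : ZMod 7) := by
        push_cast; simp only [nsmul_eq_mul]; ring
      rw [e, h7]
    rwa [hdeg] at habc
  have hwi : ∀ i, i ≠ a → i ≠ b → i ≠ c → IsWeightedHomogeneous w (X i : MvPolynomial (Fin n) k) 0 := by
    intro i hia hib hic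
    have h := isWeightedHomogeneous_X k w i
    rwa [hw0 i hia hib hic] at h
  refine ToricExit.mem_adjoin_iff_isWeightedHomogeneous_zero w G ?_ ?_ f
  · -- every generator is weight-`0` homogeneous
    rintro g (⟨s, rfl⟩ | ⟨j, rfl⟩)
    · change IsWeightedHomogeneous w (aeval r₇ (X s)) 0
      by_cases hsa : s = a
      · rw [hsa, rootA_X_a]; simpa using hwmon 7 0 0 (by norm_num)
      by_cases hsb : s = b
      · rw [hsb, rootA_X_b k n (c := c) hab]; simpa using hwmon 4 1 0 (by norm_num)
      by_cases hsc : s = c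
      · rw [hsc, rootA_X_c k n hac hbc]; simpa using hwmon 1 0 1 (by norm_num)
      · rw [rootA_X_of_ne k n hsa hsb hsc]; exact hwi s hsa hsb hsc
    · change IsWeightedHomogeneous w (q24 j) 0
      exact hwmon _ _ _ (by revert j; decide)
  · -- every weight-`0` monomial is generated: split off the passengers, then the monoid lemma
    intro d hd
    have hGi : ∀ i, i ≠ a → i ≠ b → i ≠ c → (X i : MvPolynomial (Fin n) k) ∈ A := by
      intro i hia hib hic
      rw [← rootA_X_of_ne k n hia hib hic]
      exact Algebra.subset_adjoin (Or.inl ⟨i, rfl⟩)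
    -- the passenger part `d'` and the decomposition `d = d' + α e_a + β e_b + γ e_c`
    set d' : Fin n →₀ ℕ := ((d.erase a).erase b).erase c with hd'
    have hd'a : d' a = 0 := by
      rw [hd', Finsupp.erase_ne hac, Finsupp.erase_ne hab, Finsupp.erase_same]
    have hd'b : d' b = 0 := by rw [hd', Finsupp.erase_ne hbc, Finsupp.erase_same]
    have hd'c : d' c = 0 := by rw [hd', Finsupp.erase_same]
    have hd'i : ∀ i, i ≠ a → i ≠ b → i ≠ c → d' i = d i := by
      intro i hia hib hic
      rw [hd', Finsupp.erase_ne hic, Finsupp.erase_ne hib, Finsupp.erase_ne hia]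
    have hdec : d = d' + Finsupp.single a (d a) + Finsupp.single b (d b) + Finsupp.single c (d c) := by
      ext i
      simp only [Finsupp.add_apply, Finsupp.single_apply]
      by_cases hia : i = a
      · rw [hia, hd'a, if_pos rfl, if_neg (Ne.symm hab), if_neg (Ne.symm hac)]; ring
      by_cases hib : i = b
      · rw [hib, hd'b, if_neg hab, if_pos rfl, if_neg (Ne.symm hbc)]; ring
      by_cases hic : i = c
      · rw [hic, hd'c, if_neg hac, if_neg hbc, if_pos rfl]; ring
      · rw [hd'i i hia hib hic, if_neg (fun h => hia h.symm), if_neg (fun h => hib h.symm),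
          if_neg (fun h => hic h.symm)]; ring
    -- the passenger monomial lies in `A`
    have hpass : (monomial d' (1 : k) : MvPolynomial (Fin n) k) ∈ A := by
      rw [monomial_eq, C_1, one_mul, Finsupp.prod]
      refine Subalgebra.prod_mem _ fun i hi => Subalgebra.pow_mem _ ?_ _
      have hi' : d' i ≠ 0 := Finsupp.mem_support_iff.mp hi
      have hia : i ≠ a := fun h => hi' (h ▸ hd'a)
      have hib : i ≠ b := fun h => hi' (h ▸ hd'b)
      have hic : i ≠ c := fun h => hi' (h ▸ hd'c)
      exact hGi i hia hib hic
    -- the weight of `d` is that of its `(a,b,c)`-part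
    have hwd' : Finsupp.weight w d' = 0 := by
      rw [Finsupp.weight_apply, Finsupp.sum]
      refine Finset.sum_eq_zero fun i hi => ?_
      have hi' : d' i ≠ 0 := Finsupp.mem_support_iff.mp hi
      have hia : i ≠ a := fun h => hi' (h ▸ hd'a)
      have hib : i ≠ b := fun h => hi' (h ▸ hd'b)
      have hic : i ≠ c := fun h => hi' (h ▸ hd'c)
      rw [hw0 i hia hib hic, smul_zero]
    have hdvd : 7 ∣ d a + 3 * d b + 6 * d c := by
      have h := hd
      rw [hdec, map_add, map_add, map_add, hwd', zero_add, Finsupp.weight_single,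
        Finsupp.weight_single, Finsupp.weight_single, hwa, hwb, hwc] at h
      simp only [nsmul_eq_mul, mul_one] at h
      have h' : ((d a + 3 * d b + 6 * d c : ℕ) : ZMod 7) = 0 := by
        push_cast
        linear_combination h
      exact (ZMod.natCast_eq_zero_iff _ 7).mp h'
    -- the `(a,b,c)`-part lies in `A` by the monoid lemma
    have hq : ∀ j : Fin 24, (q24 j) ∈ A := fun j => Algebra.subset_adjoin (Or.inr ⟨j, rfl⟩)
    have hra : (X a ^ 7 : MvPolynomial (Fin n) k) ∈ A := by
      rw [← rootA_X_a k n a b c]; exact Algebra.subset_adjoin (Or.inl ⟨a, rfl⟩)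
    have hrb : (X a ^ 4 * X b : MvPolynomial (Fin n) k) ∈ A := by
      rw [← rootA_X_b k n (c := c) hab]; exact Algebra.subset_adjoin (Or.inl ⟨b, rfl⟩)
    have hrc : (X a * X c : MvPolynomial (Fin n) k) ∈ A := by
      rw [← rootA_X_c k n hac hbc]; exact Algebra.subset_adjoin (Or.inl ⟨c, rfl⟩)
    have h120 : (X a * X b ^ 2 : MvPolynomial (Fin n) k) ∈ A := by simpa using hq 1
    have h013 : (X b * X c ^ 3 : MvPolynomial (Fin n) k) ∈ A := by simpa using hq 2
    have h032 : (X b ^ 3 * X c ^ 2 : MvPolynomial (Fin n) k) ∈ A := by simpa using hq 5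
    have h051 : (X b ^ 5 * X c : MvPolynomial (Fin n) k) ∈ A := by simpa using hq 10
    have h070 : (X b ^ 7 : MvPolynomial (Fin n) k) ∈ A := by simpa using hq 16
    have h007 : (X c ^ 7 : MvPolynomial (Fin n) k) ∈ A := by simpa using hq 3
    have habc := monomial_mem_of_seven_dvd k n a b c A hra hrb hrc h120 h013 h032 h051 h070 h007
      (d a) (d b) (d c) hdvd
    -- assemble
    have hmon : (monomial d (1 : k) : MvPolynomial (Fin n) k) =
        monomial d' 1 * (X a ^ d a * X b ^ d b * X c ^ d c) := by
      rw [X_pow_eq_monomial, X_pow_eq_monomial, X_pow_eq_monomial, monomial_mul, monomial_mul,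
        monomial_mul, mul_one, mul_one, mul_one]
      congr 1
      conv_lhs => rw [hdec]
      abel_nf
    rw [hmon]
    exact A.mul_mem hpass habc

end Summit.ResolutionOfSingularities.ResolutionOfSingularities.Theorems.WildQuotientResolution.Z9Peeled

end
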